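import Summits.SmoothPoincare4.SmoothPoincare4.Theorems.CongruenceShadowsShadowApproximationStubGoeritzThreeRealisersTwo
import Summits.SmoothPoincare4.SmoothPoincare4.Theorems.CongruenceShadowsShadowApproximationStubLayerStepZero
import Summits.SmoothPoincare4.SmoothPoincare4.Theorems.CongruenceShadowsNilpotentShadowsStandardStubFreeGroupGrLie
import Summits.SmoothPoincare4.SmoothPoincare4.Theorems.CongruenceShadowsShadowApproximationStubLayerStepZeroOneJohnson
import HarnessLib

/-!
# Helper III (handle twists and the reading of their conjugates) for stub `stub_layerStepZeroOne` of line
`nilpotent-genus-class`, crux `CongruenceShadows.ShadowApproximation` (item stmt-SmoothPoincare4-14595)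

Genus `3`, `S₃ = ⟨a₀,b₀,a₁,b₁,a₂,b₂ ∣ [a₀,b₀][a₁,b₁][a₂,b₂]⟩`, `Nᵢ = s4Kernels i`, `N₂ = ⟪b₀, a₁, a₂⟫`,
`γₖ₊₁ = (⊤).lowerCentralSeries k`, `𝒥₂ = {ψ ∈ Aut S₃ | ψ(s)s⁻¹ ∈ γ₃}`.

* **Handle twists** (`exists_twist`): for each handle `h` the partial conjugation `T_h` of the letters of
  handle `h` by `c_h = [a_h, b_h]` is an automorphism fixing the relator on the nose (a `RelatorAut`, all
  free-group identities by `decide`), a Goeritz element (`T_h(N₀) = N₀`, `T_h(N₁) = N₁`, kernels by erasure)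
  lying in `𝒥₂` with `T_h(x)x⁻¹ = [[a_h,b_h], x]` on handle `h` and `T_h(x) = x` off it.  (Topologically:
  the Dehn twist about `∂(handle h)`, a separating curve bounding discs in both handlebodies.)
* **Symbols.**  With the Magnus–Witt symbol maps `θₖ : F₃ → L_ℤ(y₀,y₁,y₂)` of the landed
  `stub_freeGroupGrLie` (taken as hypotheses `hadd, hker, hof, hbr` on a variable `θ`) and the erasing
  projection `π : S₃ ↠ F₃` of `N₂` (hypothesis `hπof`: `b₀, a₁, a₂ ↦ 1`, `a₀, b₁, b₂ ↦ y₀, y₁, y₂`; the cut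
  pattern is the literal `![true,false,false]`): `θ₀ ∘ π` is the reduced Hurewicz map (`theta0_pi`), and
* **`datum_conj_twist`** — THE DEGREE-TWO DATUM OF A CONJUGATED TWIST: for `x ∈ Aut S₃` inducing `F` on `H₁`
  and `T` with the letter values of `T_h`, the symbol `θ₂(π(U(X_j)X_j⁻¹))` of the value of `U = x T x⁻¹` at
  the cut letter `X_j` is `n_a ⁅⁅u,v⁆,u⁆ + n_b ⁅⁅u,v⁆,v⁆`, where `u, v ∈ L₁` are the reduced classes of
  `x(a_h), x(b_h)` and `(n_a, n_b)` the handle-`h` coordinates of `F⁻¹[X_j]` (level-`2` Johnson calculus of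
  the sibling file `…StubLayerStepZeroOneJohnson`: the value map of `T ∈ 𝒥₂` is a homomorphism to `γ₃/γ₄`
  factoring through `H₁`).
No definitions, no notations.  Registered sub-goal: `helper_handleTwistGoeritz`.
-/

set_option linter.dupNamespace false

noncomputable section

open Subgroup Literature.Topology.FourManifolds Literature.Algebra.Lie Multiplicative
open Summit.SmoothPoincare4.SmoothPoincare4.Theorems.NilpotentShadowsStandard.SaturatedTorsorDescent
open scoped commutatorElement

namespace Summit.SmoothPoincare4.SmoothPoincare4.Theorems.ShadowApproximation.NilpotentGenusClass

namespace LayerZeroOne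

/-! ## The handle twists `T_h`: conjugation of the letters of handle `h` by `c_h = [a_h, b_h]` -/

/-- An endomorphism of `S_g` congruent to the identity on the letters modulo a normal subgroup is
congruent to the identity everywhere. [folklore] -/
theorem apply_mul_inv_mem_of_gens {g : ℕ} (σ : SurfaceGroup g →* SurfaceGroup g) (N : Subgroup (SurfaceGroup g))
    [N.Normal] (hσ : ∀ x, σ (PresentedGroup.of x) * (PresentedGroup.of x)⁻¹ ∈ N) (s : SurfaceGroup g) :
    σ s * s⁻¹ ∈ N := by
  have e : (QuotientGroup.mk' N).comp σ = QuotientGroup.mk' N :=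
    PresentedGroup.ext fun x => by
      simpa only [MonoidHom.comp_apply, QuotientGroup.mk'_apply, mul_inv_mem_iff_quot] using hσ x
  have hs := DFunLike.congr_fun e s
  simp only [MonoidHom.comp_apply, QuotientGroup.mk'_apply] at hs
  exact (mul_inv_mem_iff_quot N _ _).2 hs

/-- Packaging a relator-fixing partial conjugation of handle `h` as a Goeritz element of `𝒥₂` with
prescribed letter values (the four free-group identities and the four erasure tests are supplied by the
caller, where they are decidable). [folklore] -/
theorem exists_twist_of (h : Fin 3) (f finv : surfaceGen 3 → FreeGroup (surfaceGen 3))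
    (hf : ∀ x, f x = if x.1 = h then (genA h * genB h * (genA h)⁻¹ * (genB h)⁻¹) * FreeGroup.of x *
      (genA h * genB h * (genA h)⁻¹ * (genB h)⁻¹)⁻¹ else FreeGroup.of x)
    (h1 : FreeGroup.lift f (surfaceRelator 3) = surfaceRelator 3)
    (h2 : FreeGroup.lift finv (surfaceRelator 3) = surfaceRelator 3)
    (h3 : ∀ x, FreeGroup.lift finv (f x) = FreeGroup.of x) (h4 : ∀ x, FreeGroup.lift f (finv x) = FreeGroup.of x)
    (e0 : ∀ p ∈ s4Gens 0, FreeGroup.lift (eraseGen (s4Gens 0)) (FreeGroup.lift f (FreeGroup.of p)) = 1)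
    (e0' : ∀ p ∈ s4Gens 0, FreeGroup.lift (eraseGen (s4Gens 0)) (FreeGroup.lift finv (FreeGroup.of p)) = 1)
    (e1 : ∀ p ∈ s4Gens 1, FreeGroup.lift (eraseGen (s4Gens 1)) (FreeGroup.lift f (FreeGroup.of p)) = 1)
    (e1' : ∀ p ∈ s4Gens 1, FreeGroup.lift (eraseGen (s4Gens 1)) (FreeGroup.lift finv (FreeGroup.of p)) = 1) :
    ∃ T : SurfaceGroup 3 ≃* SurfaceGroup 3,
      (s4Kernels 0).map T.toMonoidHom = s4Kernels 0 ∧ (s4Kernels 1).map T.toMonoidHom = s4Kernels 1 ∧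
      (∀ s, T s * s⁻¹ ∈ (⊤ : Subgroup (SurfaceGroup 3)).lowerCentralSeries 2) ∧
      (∀ c : Bool, T (PresentedGroup.of (h, c)) * (PresentedGroup.of (h, c) : SurfaceGroup 3)⁻¹ =
        ⁅⁅(PresentedGroup.of (h, false) : SurfaceGroup 3), (PresentedGroup.of (h, true) : SurfaceGroup 3)⁆,
          (PresentedGroup.of (h, c) : SurfaceGroup 3)⁆) ∧
      ∀ x : surfaceGen 3, x.1 ≠ h → T (PresentedGroup.of x) = PresentedGroup.of x := by
  set A : RelatorAut 3 := RelatorAut.ofGens f finv h1 h2 h3 h4 with hA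
  have hAf : ∀ x, A.toMulEquiv (PresentedGroup.of x) = PresentedGroup.mk _ (f x) := fun x => by
    rw [relatorAut_of, show A.hom = FreeGroup.lift f from rfl, FreeGroup.lift_apply_of]
  have hne : ∀ x : surfaceGen 3, x.1 ≠ h → A.toMulEquiv (PresentedGroup.of x) = PresentedGroup.of x := fun x hx => by
    rw [hAf, hf, if_neg hx]; rfl
  have hself : ∀ c : Bool, A.toMulEquiv (PresentedGroup.of (h, c)) * (PresentedGroup.of (h, c) : SurfaceGroup 3)⁻¹ =
      ⁅⁅(PresentedGroup.of (h, false) : SurfaceGroup 3), (PresentedGroup.of (h, true) : SurfaceGroup 3)⁆,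
        (PresentedGroup.of (h, c) : SurfaceGroup 3)⁆ := fun c => by
    rw [hAf, hf, if_pos rfl]
    simp only [map_mul, map_inv, genA, genB, commutatorElement_def]
    rfl
  refine ⟨A.toMulEquiv, ?_, ?_, fun s => ?_, hself, hne⟩
  · exact map_s4Kernels_eq_of_free _ A.hom A.inv (relatorAut_of _) (relatorAut_symm_of _) 0 e0 e0'
  · exact map_s4Kernels_eq_of_free _ A.hom A.inv (relatorAut_of _) (relatorAut_symm_of _) 1 e1 e1'
  · refine apply_mul_inv_mem_of_gens A.toMulEquiv.toMonoidHom _ (fun x => ?_) s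
    obtain ⟨i, c⟩ := x
    rw [MulEquiv.coe_toMonoidHom]
    by_cases hi : i = h
    · subst hi
      rw [hself]
      exact commutator_mem_commutator (commutator_mem_commutator (mem_top _) (mem_top _)) (mem_top _)
    · rw [hne (i, c) hi, mul_inv_cancel]
      exact one_mem _

/-- **The handle twists `T_h ∈ Aut S₃`** (`h < 3`): the Dehn twist about `∂(handle h)`, algebraically the
partial conjugation of handle `h` by `c_h = [a_h, b_h]` (it fixes the relator `[a₀,b₀][a₁,b₁][a₂,b₂]` on
the nose since `c_h` commutes with `[a_h,b_h] = c_h`).  It is a Goeritz element (indeed in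
`Stab N₀ ∩ Stab N₁ ∩ Stab N₂`, kernels by erasure), lies in `𝒥₂` with `T_h(x)x⁻¹ = [[a_h,b_h], x]` on the
letters `x` of handle `h`, and fixes the other letters. [folklore] -/
theorem exists_twist (h : Fin 3) : ∃ T : SurfaceGroup 3 ≃* SurfaceGroup 3,
    (s4Kernels 0).map T.toMonoidHom = s4Kernels 0 ∧ (s4Kernels 1).map T.toMonoidHom = s4Kernels 1 ∧
    (∀ s, T s * s⁻¹ ∈ (⊤ : Subgroup (SurfaceGroup 3)).lowerCentralSeries 2) ∧
    (∀ c : Bool, T (PresentedGroup.of (h, c)) * (PresentedGroup.of (h, c) : SurfaceGroup 3)⁻¹ =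
      ⁅⁅(PresentedGroup.of (h, false) : SurfaceGroup 3), (PresentedGroup.of (h, true) : SurfaceGroup 3)⁆,
        (PresentedGroup.of (h, c) : SurfaceGroup 3)⁆) ∧
    ∀ x : surfaceGen 3, x.1 ≠ h → T (PresentedGroup.of x) = PresentedGroup.of x := by
  fin_cases h
  · exact exists_twist_of 0
      (fun x => if x.1 = (0 : Fin 3) then (genA (0 : Fin 3) * genB (0 : Fin 3) * (genA (0 : Fin 3))⁻¹ * (genB (0 : Fin 3))⁻¹) * FreeGroup.of x *
        (genA (0 : Fin 3) * genB (0 : Fin 3) * (genA (0 : Fin 3))⁻¹ * (genB (0 : Fin 3))⁻¹)⁻¹ else FreeGroup.of x)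
      (fun x => if x.1 = (0 : Fin 3) then (genA (0 : Fin 3) * genB (0 : Fin 3) * (genA (0 : Fin 3))⁻¹ * (genB (0 : Fin 3))⁻¹)⁻¹ * FreeGroup.of x *
        (genA (0 : Fin 3) * genB (0 : Fin 3) * (genA (0 : Fin 3))⁻¹ * (genB (0 : Fin 3))⁻¹) else FreeGroup.of x)
      (fun _ => rfl) (by decide) (by decide) (by decide) (by decide) (by decide) (by decide) (by decide) (by decide)
  · exact exists_twist_of 1
      (fun x => if x.1 = (1 : Fin 3) then (genA (1 : Fin 3) * genB (1 : Fin 3) * (genA (1 : Fin 3))⁻¹ * (genB (1 : Fin 3))⁻¹) * FreeGroup.of x *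
        (genA (1 : Fin 3) * genB (1 : Fin 3) * (genA (1 : Fin 3))⁻¹ * (genB (1 : Fin 3))⁻¹)⁻¹ else FreeGroup.of x)
      (fun x => if x.1 = (1 : Fin 3) then (genA (1 : Fin 3) * genB (1 : Fin 3) * (genA (1 : Fin 3))⁻¹ * (genB (1 : Fin 3))⁻¹)⁻¹ * FreeGroup.of x *
        (genA (1 : Fin 3) * genB (1 : Fin 3) * (genA (1 : Fin 3))⁻¹ * (genB (1 : Fin 3))⁻¹) else FreeGroup.of x)
      (fun _ => rfl) (by decide) (by decide) (by decide) (by decide) (by decide) (by decide) (by decide) (by decide)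
  · exact exists_twist_of 2
      (fun x => if x.1 = (2 : Fin 3) then (genA (2 : Fin 3) * genB (2 : Fin 3) * (genA (2 : Fin 3))⁻¹ * (genB (2 : Fin 3))⁻¹) * FreeGroup.of x *
        (genA (2 : Fin 3) * genB (2 : Fin 3) * (genA (2 : Fin 3))⁻¹ * (genB (2 : Fin 3))⁻¹)⁻¹ else FreeGroup.of x)
      (fun x => if x.1 = (2 : Fin 3) then (genA (2 : Fin 3) * genB (2 : Fin 3) * (genA (2 : Fin 3))⁻¹ * (genB (2 : Fin 3))⁻¹)⁻¹ * FreeGroup.of x *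
        (genA (2 : Fin 3) * genB (2 : Fin 3) * (genA (2 : Fin 3))⁻¹ * (genB (2 : Fin 3))⁻¹) else FreeGroup.of x)
      (fun _ => rfl) (by decide) (by decide) (by decide) (by decide) (by decide) (by decide) (by decide) (by decide)

/-! ## Symbols: the Magnus–Witt maps `θₖ` of `F₃` and the erasing projection `π : S₃ ↠ F₃` of `N₂` -/

/-! Throughout, the CUT PATTERN of `N₂ = ⟪b₀, a₁, a₂⟫` is the literal `![true, false, false] : Fin 3 → Bool`:
`(h, ![true,false,false] h)` is the cut letter of handle `h` and its mate `(h, !…)` survives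
(`a₀ ↦ y₀`, `b₁ ↦ y₁`, `b₂ ↦ y₂` under the erasing projection `π : S₃ ↠ F₃`). -/

section Symbols

variable (θ : ℕ → FreeGroup (Fin 3) → FreeLieAlgebra ℤ (Fin 3))
  (hadd : ∀ k, ∀ x ∈ (⊤ : Subgroup (FreeGroup (Fin 3))).lowerCentralSeries k,
    ∀ y ∈ (⊤ : Subgroup (FreeGroup (Fin 3))).lowerCentralSeries k, θ k (x * y) = θ k x + θ k y)
  (hker : ∀ k, ∀ x ∈ (⊤ : Subgroup (FreeGroup (Fin 3))).lowerCentralSeries k,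
    θ k x = 0 ↔ x ∈ (⊤ : Subgroup (FreeGroup (Fin 3))).lowerCentralSeries (k + 1))
  (hof : ∀ i : Fin 3, θ 0 (FreeGroup.of i) = FreeLieAlgebra.of ℤ i)
  (hbr : ∀ j k, ∀ x ∈ (⊤ : Subgroup (FreeGroup (Fin 3))).lowerCentralSeries j,
    ∀ y ∈ (⊤ : Subgroup (FreeGroup (Fin 3))).lowerCentralSeries k, θ (j + k + 1) ⁅x, y⁆ = ⁅θ j x, θ k y⁆)
  (π : SurfaceGroup 3 →* FreeGroup (Fin 3))
  (hπof : ∀ (h : Fin 3) (b : Bool), π (PresentedGroup.of (h, b)) = if b = (![true, false, false] : Fin 3 → Bool) h then 1 else FreeGroup.of h)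

include hadd in
/-- `θₖ 1 = 0`. [folklore] -/
theorem theta_one (k : ℕ) : θ k 1 = 0 := by
  have h := hadd k 1 (one_mem _) 1 (one_mem _)
  rw [mul_one] at h
  simpa using h

include hadd in
/-- `θₖ x⁻¹ = -θₖ x` on `γₖ₊₁`. [folklore] -/
theorem theta_inv (k : ℕ) {x : FreeGroup (Fin 3)} (hx : x ∈ (⊤ : Subgroup (FreeGroup (Fin 3))).lowerCentralSeries k) :
    θ k x⁻¹ = -θ k x := by
  have h := hadd k x hx x⁻¹ (inv_mem hx)
  rw [mul_inv_cancel, theta_one θ hadd] at h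
  exact eq_neg_of_add_eq_zero_right h.symm

include hadd in
/-- `θₖ (x ^ n) = n • θₖ x` on `γₖ₊₁`. [folklore] -/
theorem theta_zpow (k : ℕ) {x : FreeGroup (Fin 3)} (hx : x ∈ (⊤ : Subgroup (FreeGroup (Fin 3))).lowerCentralSeries k)
    (n : ℤ) : θ k (x ^ n) = n • θ k x := by
  induction n using Int.induction_on with
  | zero => rw [zpow_zero, theta_one θ hadd, zero_smul]
  | succ n ih => rw [zpow_add_one, hadd k _ (zpow_mem hx _) _ hx, ih, add_smul, one_smul]
  | pred n ih => rw [zpow_sub_one, hadd k _ (zpow_mem hx _) _ (inv_mem hx), ih, theta_inv θ hadd k hx, sub_smul,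
      one_smul, sub_eq_add_neg]

include hadd hker in
/-- `θₖ` ignores factors from `γₖ₊₂`. [folklore] -/
theorem theta_mul_of_mem_succ (k : ℕ) {x y : FreeGroup (Fin 3)}
    (hx : x ∈ (⊤ : Subgroup (FreeGroup (Fin 3))).lowerCentralSeries (k + 1))
    (hy : y ∈ (⊤ : Subgroup (FreeGroup (Fin 3))).lowerCentralSeries k) : θ k (x * y) = θ k y := by
  rw [hadd k x (lcs_antitone (Nat.le_succ k) hx) y hy, (hker k x (lcs_antitone (Nat.le_succ k) hx)).2 hx, zero_add]

include hadd hker in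
/-- **`θ₂ ∘ π` is constant on classes modulo `γ₄`** (within `γ₃`). [folklore] -/
theorem theta2_pi_congr {u v : SurfaceGroup 3} (hv : v ∈ (⊤ : Subgroup (SurfaceGroup 3)).lowerCentralSeries 2)
    (h : ((u : SurfaceGroup 3) : SurfaceGroup 3 ⧸ (⊤ : Subgroup (SurfaceGroup 3)).lowerCentralSeries 3) = v) :
    θ 2 (π u) = θ 2 (π v) := by
  rw [← mul_inv_mem_iff_quot] at h
  have e : u = (u * v⁻¹) * v := by rw [inv_mul_cancel_right]
  rw [e, map_mul]
  exact theta_mul_of_mem_succ θ hadd hker 2 (FreeGroupGrLie.map_mem_lcs π h) (FreeGroupGrLie.map_mem_lcs π hv)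

include hπof in
/-- The cut letters die under `π`. [folklore] -/
theorem pi_cut (h : Fin 3) : π (PresentedGroup.of (h, (![true, false, false] : Fin 3 → Bool) h)) = 1 := by
  rw [hπof, if_pos rfl]

include hπof in
/-- The surviving letters go to the free generators. [folklore] -/
theorem pi_mate (h : Fin 3) : π (PresentedGroup.of (h, !(![true, false, false] : Fin 3 → Bool) h)) = FreeGroup.of h := by
  rw [hπof, if_neg (by fin_cases h <;> decide)]

include hadd hof hπof in
/-- **`θ₀ ∘ π` is the reduced Hurewicz map**: `θ₀(π s) = [s]_{a₀} y₀ + [s]_{b₁} y₁ + [s]_{b₂} y₂`. [folklore] -/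
theorem theta0_pi (s : SurfaceGroup 3) :
    θ 0 (π s) = ((toAdd (SurfaceGroup.abelianize 3 s)) ((0 : Fin 3), false) • FreeLieAlgebra.of ℤ (0 : Fin 3) + (toAdd (SurfaceGroup.abelianize 3 s)) ((1 : Fin 3), true) • FreeLieAlgebra.of ℤ (1 : Fin 3) +
        (toAdd (SurfaceGroup.abelianize 3 s)) ((2 : Fin 3), true) • FreeLieAlgebra.of ℤ (2 : Fin 3)) := by
  -- both sides are homomorphisms `S₃ → (L, +)` agreeing on the letters
  set A : SurfaceGroup 3 →* Multiplicative (FreeLieAlgebra ℤ (Fin 3)) :=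
    { toFun := fun s => ofAdd (θ 0 (π s))
      map_one' := by rw [map_one, theta_one θ hadd]; rfl
      map_mul' := fun s t => by rw [map_mul, hadd 0 _ (mem_top _) _ (mem_top _)]; rfl } with hA
  set B : SurfaceGroup 3 →* Multiplicative (FreeLieAlgebra ℤ (Fin 3)) :=
    { toFun := fun s => ofAdd ((toAdd (SurfaceGroup.abelianize 3 s)) ((0 : Fin 3), false) • FreeLieAlgebra.of ℤ (0 : Fin 3) + (toAdd (SurfaceGroup.abelianize 3 s)) ((1 : Fin 3), true) • FreeLieAlgebra.of ℤ (1 : Fin 3) +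
        (toAdd (SurfaceGroup.abelianize 3 s)) ((2 : Fin 3), true) • FreeLieAlgebra.of ℤ (2 : Fin 3))
      map_one' := by rw [map_one, toAdd_one]; simp
      map_mul' := fun s t => by
        rw [map_mul, toAdd_mul, ← ofAdd_add]
        simp only [Pi.add_apply, add_smul]
        congr 1; abel } with hB
  suffices hAB : A = B by
    have := DFunLike.congr_fun hAB s
    simp only [hA, hB, MonoidHom.coe_mk, OneHom.coe_mk] at this
    exact ofAdd.injective this
  refine PresentedGroup.ext fun x => ?_
  obtain ⟨h, b⟩ := x
  simp only [hA, hB, MonoidHom.coe_mk, OneHom.coe_mk, SurfaceGroup.abelianize_of, toAdd_ofAdd, hπof]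
  congr 1
  fin_cases h <;> cases b <;> simp [hof, theta_one θ hadd]

include hadd in
/-- `θ₂ ∘ π` of a product of two powers inside `γ₃`. [folklore] -/
theorem theta2_pi_mul_zpow {u v : SurfaceGroup 3} (hu : u ∈ (⊤ : Subgroup (SurfaceGroup 3)).lowerCentralSeries 2)
    (hv : v ∈ (⊤ : Subgroup (SurfaceGroup 3)).lowerCentralSeries 2) (m n : ℤ) :
    θ 2 (π (u ^ m * v ^ n)) = m • θ 2 (π u) + n • θ 2 (π v) := by
  have hu' := FreeGroupGrLie.map_mem_lcs π hu
  have hv' := FreeGroupGrLie.map_mem_lcs π hv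
  rw [map_mul, map_zpow, map_zpow, hadd 2 _ (zpow_mem hu' m) _ (zpow_mem hv' n), theta_zpow θ hadd 2 hu',
    theta_zpow θ hadd 2 hv']

include hbr in
/-- `θ₂` of a left-normed double commutator of arbitrary elements is the double bracket of their
degree-one symbols. [folklore] -/
theorem theta2_comm_comm (P Q R : FreeGroup (Fin 3)) : θ 2 ⁅⁅P, Q⁆, R⁆ = ⁅⁅θ 0 P, θ 0 Q⁆, θ 0 R⁆ := by
  have h1 := hbr 1 0 ⁅P, Q⁆ (commutator_mem_commutator (mem_top P) (mem_top Q)) R (mem_top R)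
  have h2 := hbr 0 0 P (mem_top P) Q (mem_top Q)
  rw [show (1 + 0 + 1 : ℕ) = 2 from rfl] at h1
  rw [show (0 + 0 + 1 : ℕ) = 1 from rfl] at h2
  rw [h1, h2]

include hadd hker hof hbr hπof in
/-- **The degree-two datum of a conjugated handle twist.** For `x ∈ Aut S₃` inducing `F` on `H₁` and an
automorphism `T ∈ 𝒥₂` with the values of the handle twist `T_h` on the letters
(`T(x)x⁻¹ = [[a_h,b_h], x]` on handle `h`, `T(x) = x` off it), the symbol of the value of `U = x T x⁻¹` at
the cut letter `X_j` of `N₂` is `n_a ⁅⁅u,v⁆,u⁆ + n_b ⁅⁅u,v⁆,v⁆` with `u, v` the reduced classes of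
`x(a_h), x(b_h)` and `(n_a, n_b)` the handle-`h` coordinates of `x⁻¹(X_j)` (Johnson calculus modulo `γ₄`:
the value map of `T` is a homomorphism to `γ₃/γ₄` factoring through `H₁`). [folklore] -/
theorem datum_conj_twist (x T : SurfaceGroup 3 ≃* SurfaceGroup 3) (F : (surfaceGen 3 → ℤ) ≃ₗ[ℤ] (surfaceGen 3 → ℤ))
    (hx : ∀ s, toAdd (SurfaceGroup.abelianize 3 (x s)) = F (toAdd (SurfaceGroup.abelianize 3 s))) (h : Fin 3)
    (hT2 : ∀ s, T s * s⁻¹ ∈ (⊤ : Subgroup (SurfaceGroup 3)).lowerCentralSeries 2)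
    (hTh : ∀ c : Bool, T (PresentedGroup.of (h, c)) * (PresentedGroup.of (h, c) : SurfaceGroup 3)⁻¹ =
      ⁅⁅(PresentedGroup.of (h, false) : SurfaceGroup 3), (PresentedGroup.of (h, true) : SurfaceGroup 3)⁆,
        (PresentedGroup.of (h, c) : SurfaceGroup 3)⁆)
    (hTne : ∀ y : surfaceGen 3, y.1 ≠ h → T (PresentedGroup.of y) = PresentedGroup.of y) (j : Fin 3) :
    θ 2 (π ((x.symm.trans (T.trans x)) (PresentedGroup.of (j, (![true, false, false] : Fin 3 → Bool) j)) *
        (PresentedGroup.of (j, (![true, false, false] : Fin 3 → Bool) j) : SurfaceGroup 3)⁻¹)) =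
      (F.symm (Pi.single (j, (![true, false, false] : Fin 3 → Bool) j) 1)) (h, false) •
        ⁅⁅((F (Pi.single (h, false) 1)) ((0 : Fin 3), false) • FreeLieAlgebra.of ℤ (0 : Fin 3) +
          (F (Pi.single (h, false) 1)) ((1 : Fin 3), true) • FreeLieAlgebra.of ℤ (1 : Fin 3) +
          (F (Pi.single (h, false) 1)) ((2 : Fin 3), true) • FreeLieAlgebra.of ℤ (2 : Fin 3)),
          ((F (Pi.single (h, true) 1)) ((0 : Fin 3), false) • FreeLieAlgebra.of ℤ (0 : Fin 3) +
          (F (Pi.single (h, true) 1)) ((1 : Fin 3), true) • FreeLieAlgebra.of ℤ (1 : Fin 3) +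
          (F (Pi.single (h, true) 1)) ((2 : Fin 3), true) • FreeLieAlgebra.of ℤ (2 : Fin 3))⁆,
          ((F (Pi.single (h, false) 1)) ((0 : Fin 3), false) • FreeLieAlgebra.of ℤ (0 : Fin 3) +
          (F (Pi.single (h, false) 1)) ((1 : Fin 3), true) • FreeLieAlgebra.of ℤ (1 : Fin 3) +
          (F (Pi.single (h, false) 1)) ((2 : Fin 3), true) • FreeLieAlgebra.of ℤ (2 : Fin 3))⁆ +
      (F.symm (Pi.single (j, (![true, false, false] : Fin 3 → Bool) j) 1)) (h, true) •
        ⁅⁅((F (Pi.single (h, false) 1)) ((0 : Fin 3), false) • FreeLieAlgebra.of ℤ (0 : Fin 3) +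
          (F (Pi.single (h, false) 1)) ((1 : Fin 3), true) • FreeLieAlgebra.of ℤ (1 : Fin 3) +
          (F (Pi.single (h, false) 1)) ((2 : Fin 3), true) • FreeLieAlgebra.of ℤ (2 : Fin 3)),
          ((F (Pi.single (h, true) 1)) ((0 : Fin 3), false) • FreeLieAlgebra.of ℤ (0 : Fin 3) +
          (F (Pi.single (h, true) 1)) ((1 : Fin 3), true) • FreeLieAlgebra.of ℤ (1 : Fin 3) +
          (F (Pi.single (h, true) 1)) ((2 : Fin 3), true) • FreeLieAlgebra.of ℤ (2 : Fin 3))⁆,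
          ((F (Pi.single (h, true) 1)) ((0 : Fin 3), false) • FreeLieAlgebra.of ℤ (0 : Fin 3) +
          (F (Pi.single (h, true) 1)) ((1 : Fin 3), true) • FreeLieAlgebra.of ℤ (1 : Fin 3) +
          (F (Pi.single (h, true) 1)) ((2 : Fin 3), true) • FreeLieAlgebra.of ℤ (2 : Fin 3))⁆ := by
  set X : SurfaceGroup 3 := PresentedGroup.of (j, (![true, false, false] : Fin 3 → Bool) j) with hX
  set n : surfaceGen 3 → ℤ := F.symm (Pi.single (j, (![true, false, false] : Fin 3 → Bool) j) 1) with hn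
  set a : SurfaceGroup 3 := PresentedGroup.of (h, false) with ha
  set b : SurfaceGroup 3 := PresentedGroup.of (h, true) with hb
  rw [conj_tau]
  set t := x.symm X with ht
  -- the class of `t`
  have habt : toAdd (SurfaceGroup.abelianize 3 t) = n := by
    have h1 := hx t
    rw [ht, MulEquiv.apply_symm_apply, hX, SurfaceGroup.abelianize_of, toAdd_ofAdd] at h1
    rw [hn, h1, LinearEquiv.symm_apply_apply]
  -- a product of powers of letters in the class of `t`, handle `h` first
  set restF : Finset (surfaceGen 3) := Finset.univ.filter fun l => l.1 ≠ h with hrestF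
  set r : SurfaceGroup 3 := (restF.toList.map fun l => (PresentedGroup.of l : SurfaceGroup 3) ^ n l).prod with hr
  set t₀ : SurfaceGroup 3 := a ^ n (h, false) * b ^ n (h, true) * r with ht₀
  have hab_r : toAdd (SurfaceGroup.abelianize 3 r) = ∑ l ∈ restF, n l • Pi.single l (1 : ℤ) := by
    rw [hr, map_list_prod, List.map_map, Finset.prod_map_toList, toAdd_prod]
    refine Finset.sum_congr rfl fun l _ => ?_
    simp only [Function.comp_apply, map_zpow, SurfaceGroup.abelianize_of, toAdd_zpow, toAdd_ofAdd]
  have hab_t₀ : toAdd (SurfaceGroup.abelianize 3 t₀) = n := by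
    simp only [ht₀, MonoidHom.map_mul, MonoidHom.map_zpow, toAdd_mul, toAdd_zpow, hab_r, ha, hb,
      SurfaceGroup.abelianize_of, toAdd_ofAdd]
    have hsplit := Finset.sum_filter_add_sum_filter_not Finset.univ (fun l : surfaceGen 3 => l.1 ≠ h)
      (fun l => n l • Pi.single l (1 : ℤ))
    have hpair : (Finset.univ.filter fun l : surfaceGen 3 => ¬ l.1 ≠ h) = {(h, false), (h, true)} := by
      ext ⟨i, c⟩
      simp only [Finset.mem_filter, Finset.mem_univ, true_and, not_not, Finset.mem_insert, Finset.mem_singleton,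
        Prod.mk.injEq]
      cases c <;> simp
    have hsingle : ∀ l : surfaceGen 3, n l • (Pi.single l (1 : ℤ) : surfaceGen 3 → ℤ) =
        (Pi.single l (n l) : surfaceGen 3 → ℤ) := fun l => by
      ext y; by_cases hy : y = l
      · subst hy; simp
      · simp [Pi.single_eq_of_ne hy]
    rw [hpair, Finset.sum_pair (by simp)] at hsplit
    simp only [hsingle, Finset.univ_sum_single] at hsplit ⊢
    conv_rhs => rw [← hsplit]
    rw [hrestF]
    abel
  have htt₀ : t * t₀⁻¹ ∈ (⊤ : Subgroup (SurfaceGroup 3)).lowerCentralSeries 1 :=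
    mul_inv_mem_γ₂ (habt.trans hab_t₀.symm)
  -- the value of `T` at `t` modulo `γ₄`
  have hTr : T r = r := by
    rw [hr, map_list_prod, List.map_map]
    refine congrArg List.prod (List.map_congr_left fun l hl => ?_)
    rw [Finset.mem_toList, hrestF, Finset.mem_filter] at hl
    rw [Function.comp_apply, map_zpow, hTne l hl.2]
  have hval : (((T t * t⁻¹ : SurfaceGroup 3)) : SurfaceGroup 3 ⧸ (⊤ : Subgroup (SurfaceGroup 3)).lowerCentralSeries 3) =
      ((⁅⁅a, b⁆, a⁆ ^ n (h, false) * ⁅⁅a, b⁆, b⁆ ^ n (h, true) : SurfaceGroup 3) : SurfaceGroup 3 ⧸ _) := by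
    rw [jk_quot_congr hT2 htt₀, ht₀, jk_quot_mul hT2, jk_quot_mul hT2, jk_quot_zpow hT2, jk_quot_zpow hT2,
      hTr, mul_inv_cancel, QuotientGroup.mk_one, mul_one, ha, hb, hTh, hTh,
      QuotientGroup.mk_mul, QuotientGroup.mk_zpow, QuotientGroup.mk_zpow]
  -- push through `x`, `π`, `θ₂`
  have hmem : (⁅⁅a, b⁆, a⁆ ^ n (h, false) * ⁅⁅a, b⁆, b⁆ ^ n (h, true) : SurfaceGroup 3) ∈
      (⊤ : Subgroup (SurfaceGroup 3)).lowerCentralSeries 2 :=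
    mul_mem (zpow_mem (commutator_mem_commutator (commutator_mem_commutator (mem_top _) (mem_top _)) (mem_top _)) _)
      (zpow_mem (commutator_mem_commutator (commutator_mem_commutator (mem_top _) (mem_top _)) (mem_top _)) _)
  have hval' : ((x (T t * t⁻¹) : SurfaceGroup 3) : SurfaceGroup 3 ⧸ (⊤ : Subgroup (SurfaceGroup 3)).lowerCentralSeries 3) =
      ((x (⁅⁅a, b⁆, a⁆ ^ n (h, false) * ⁅⁅a, b⁆, b⁆ ^ n (h, true)) : SurfaceGroup 3) : SurfaceGroup 3 ⧸ _) := by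
    rw [← mul_inv_mem_iff_quot] at hval ⊢
    simpa only [map_mul, map_inv] using equiv_mem_lcs x hval
  rw [theta2_pi_congr θ hadd hker π (equiv_mem_lcs x hmem) hval', map_mul, map_zpow, map_zpow,
    theta2_pi_mul_zpow θ hadd π (equiv_mem_lcs x (commutator_mem_commutator
      (commutator_mem_commutator (mem_top _) (mem_top _)) (mem_top _))) (equiv_mem_lcs x (commutator_mem_commutator
      (commutator_mem_commutator (mem_top _) (mem_top _)) (mem_top _)))]
  simp only [map_commutatorElement, theta2_comm_comm θ hbr, theta0_pi θ hadd hof π hπof, hx, ha, hb,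
    SurfaceGroup.abelianize_of, toAdd_ofAdd]


end Symbols

end LayerZeroOne


/-- **Registered helper `helper_handleTwistGoeritz`** (sub-goal of stub `stub_layerStepZeroOne`, item
stmt-SmoothPoincare4-14595): the handle twists as Goeritz elements of `𝒥₂` with their letter values, in
closed form. [folklore] -/
theorem helper_handleTwistGoeritz : ∀ h : Fin 3, ∃ T : SurfaceGroup 3 ≃* SurfaceGroup 3, (s4Kernels 0).map T.toMonoidHom = s4Kernels 0 ∧ (s4Kernels 1).map T.toMonoidHom = s4Kernels 1 ∧ (∀ s : SurfaceGroup 3, T s * s⁻¹ ∈ (⊤ : Subgroup (SurfaceGroup 3)).lowerCentralSeries 2) ∧ (∀ c : Bool, T (PresentedGroup.of (h, c)) * (PresentedGroup.of (h, c) : SurfaceGroup 3)⁻¹ = ((PresentedGroup.of (h, false) : SurfaceGroup 3) * (PresentedGroup.of (h, true) : SurfaceGroup 3) * (PresentedGroup.of (h, false) : SurfaceGroup 3)⁻¹ * (PresentedGroup.of (h, true) : SurfaceGroup 3)⁻¹) * (PresentedGroup.of (h, c) : SurfaceGroup 3) * ((PresentedGroup.of (h, false) : SurfaceGroup 3) *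 (PresentedGroup.of (h, true) : SurfaceGroup 3) * (PresentedGroup.of (h, false) : SurfaceGroup 3)⁻¹ * (PresentedGroup.of (h, true) : SurfaceGroup 3)⁻¹)⁻¹ * (PresentedGroup.of (h, c) : SurfaceGroup 3)⁻¹) ∧ ∀ x : surfaceGen 3, x.1 ≠ h → T (PresentedGroup.of x) = PresentedGroup.of x := by
  intro h
  obtain ⟨T, h0, h1, h2, h3, h4⟩ := LayerZeroOne.exists_twist h
  refine ⟨T, h0, h1, h2, fun c => ?_, h4⟩
  rw [h3 c, commutatorElement_def, commutatorElement_def]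

end Summit.SmoothPoincare4.SmoothPoincare4.Theorems.ShadowApproximation.NilpotentGenusClass

end
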